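import Summits.QuantumFields.YangMills.Theorems.BalabanUVNodesN19ModellingLetterOfPeierlsDomination

/-!
# BalabanUVNodes ∕ node N19 (NE7) — THE K-DEPENDENT BUDGET EDITION OF THE (V‑a) RATE (CRIT-1 N6): a UV-growing budget `b_K ≤ b₀ + δ·log K`
# costs `(Λ+ζ)·δ` of exponent — p621610's over-age rate ∕ √-summability with the budget letter relaxed, and the Peierls-letter plug

Cell `pub-ymgap` (HUMAN RULING D-0062 Track A ∕ director-ym R399 (3a) second-wave width seats), WIDTH SEAT `pub-ymgap-dag-n19-w4` (node n19 = NE7),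
generation g7, CLAIM-2 ∕ INTENT-2 (bus 2026-08-28T09:58Z).  Key item K3⁷ `SpineGivenEndpointR13SepCoPH` (stmt-QuantumFields-20544; skeleton of record v5
941dddb108cbaacf, stub 2 `stub_expansion13H`); filed `--kind proof --supports … --as helper`.  COUNT-NEUTRAL.  THEOREMS ONLY (0 `def`, 0 `instance`, 0 `notation`,
0 `sorry`).  ADDITIVE — imports this seat's p623281 `…N19ModellingLetterOfPeierlsDomination` ONLY (through it dag-n20-w5's p622199 ∕ p621610 and Mathlib).

WHY.  p621610 (dag-n20-w5 g4, idea-3 g14's `RefreshProcessSketch.lean` §14 ported) assembles the one-run over-aged («wild») mass rate along `K` with ONE UNIFORM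
budget `b` (threshold `x_K = b + κ₁·log K`, over-age `m − b`) — its header and the sketch's both flag «the memo's sub-polynomial `K^{o(1)}` refinement for UV-growing
budgets is NOT formalised: a uniform `b` is assumed».  CRIT-1 g6's re-price (`Cruxes/…/CRIT-1-REPRICE-hellinger-ed6-refresh-kernel-ed3.md`) nit **N6** prices the
refinement: «a UV-growing budget `b_K ≤ b₀ + δ·log K` enters §14.6 as `e^{(θ−r)b_K} = e^{(Λ+ζ)b₀}·K^{(Λ+ζ)δ}`, i.e. the exponent becomes `κ₁(θ−Λ−ζ) − (Λ+ζ)δ`; the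
strict inequality `> 2` absorbs every `δ < (κ₁(θ−Λ−ζ) − 2)∕(Λ+ζ)` … worth one displayed line when ported».  THIS FILE is that line, typed:
* §1 ★★ `wildMass_rateAlongK_of_refreshProcess_growingBudget` — p621610's ONE-`(K,t)` `wildMass_rate_of_refreshProcess` BY NAME at the budget `b K`, threshold
  `x_K = b K + κ₁·log K`, over-age `m − b K`, with `0 ≤ Λ + ζ` and the GROWTH letter `b K ≤ b₀ + δ·log K` (`K ≥ 1`) ⇒ for `K ≥ 1`, `|t| ≤ l₀`:
  `wild K t ≤ C·e^{−(κ₁(θ−Λ−ζ) − (Λ+ζ)δ)·log K}` with `C = C₀·e^{Z₀}·e^{(Λ+ζ)b₀}∕(1 − e^{−(θ−Λ−ζ)})`.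
* §2 ★★★ `wildMass_summable_of_refreshProcess_growingBudget` — `2 < κ₁(θ−Λ−ζ) − (Λ+ζ)δ` ⇒ the (V‑a) block `∃ wm ≥ 0, Summable √wm, wild K t ≤ wm K` (p621610's
  `summable_sqrt_of_le_exp_log` BY NAME); `wildMass_summableOne_of_refreshProcess_growingBudget` — `1 < …` ⇒ `Summable wm` (`window-key-core`'s (AC)).
* §3 ★★ `wildMass_summable_of_peierlsLetters_growingBudget` — the K-dependent `hmodel` SUPPLIED by p623281's one-`(K,t)` composition
  `modellingLetter_of_peierlsLetters` at budget `b K` ((KR-dc) + (PEND at over-age `m − b K`) + (POS) + (BIRTH)) ⇒ the (V‑a) block.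
* §4 toys (A6): `δ = 0` is p621610's exponent verbatim; a numeric inhabitant of the strengthened margin with `δ = 1` (`L = 2`, `θ = 10`, `ζ = e^{−10}`, `κ₁ = 1`).
CREDIT.  The refresh process and its assembly: idea-3 g13∕g14 + dag-n20-w5 g4 (p621610, CONSUMED BY NAME — its uniform-`b` theorems are the `δ = 0` case, nothing
restated); the pricing N6: CRIT-1 g6.  LOCATED (dag-n20-w4 g3, bus 09:18Z): in the TREE-KERNEL currency the K-uniform credit-vs-window clause is
`T4PersistentHistoryCount.credit_dominates_window{,_poly}` — a different currency; this file is the abstract-process twin.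

HONEST FRAMING.  [folklore] real analysis on HYPOTHESIS SHAPES.  The growth letter `b_K ≤ b₀ + δ log K`, every refresh-process letter of p621610 (event sets,
factors, prices, epochs, rate `θ`, entropy `Z₀ + ζm`, block entropy `Λ`), the modelling letter `hmodel` or its Peierls suppliers (KR-dc), (PEND), (POS), (BIRTH)
are HYPOTHESES produced by nobody (idea-3's READING of [LF‑II] (1.79)–(1.85), re-priced located A∧B by CRIT-1; NOT asserted, NOT kernel against any datum).
NO estimate of Bałaban's programme is proved; nothing of Bałaban's asserted or instantiated (no `Provisos₁₃CoPH` tuple — K0⁷ OPEN); (V‑b) = (YG), (R′), (R‑c)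
untouched and UNPRINTED for d = 4; NE7 ∕ NE7b ∕ NE7c NOT PRINTED as two-run statements for d = 4 and NOT proved; N19 ∕ N20 NOT discharged; K3⁷ OPEN, v5 STANDS,
not claimed; no summit statement is proved by this seat; counts UNMOVED.  One finite four-torus programme at fixed ε — NOT ℝ⁴, NOT infinite volume, NOT OS, NOT
a mass gap, NOT the Clay problem (R4 closes the conditional finite-𝕋⁴ rung `BalabanLadder.UV` only).  0 `def`; 0 `sorry`; standard axioms; no cite tags.
-/

noncomputable section

namespace Summit.QuantumFields.YangMills.BalabanUVNodes.N19OverAgeRateGrowingBudget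
open Finset
open Summit.QuantumFields.YangMills.BalabanUVNodes.N20OverAgeRefreshProcess
  (wildMass_rate_of_refreshProcess summable_sqrt_of_le_exp_log summable_of_le_exp_log)
open Summit.QuantumFields.YangMills.BalabanUVNodes.N19ModellingLetterOfPeierlsDomination (modellingLetter_of_peierlsLetters)

/-! ## §1 The rate along `K` with a growing budget (the growth letter enters as `e^{(Λ+ζ)b_K} ≤ e^{(Λ+ζ)b₀}·e^{(Λ+ζ)δ·log K}`) -/

section Rate
variable {α : Type*}

/-- **★★ ALONG `K`, RATE FORM, GROWING BUDGET** (CRIT-1 N6).  p621610's refresh-process letters per `(K, t, m)` — event sets `U`, factors `0 ≤ w ≤ e^{−P}` on `U`,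
epochs `ℓ`, uniform rate `θ ≥ 0` (`θ·ℓ ≤ P∕2`), entropy `Σ_U e^{−P∕2} ≤ Z₀ + ζ m`, block entropy `Λ` with `Λ + ζ < θ` — now with a K-DEPENDENT budget `b K`
obeying the GROWTH letter `b K ≤ b₀ + δ·log K` (`K ≥ 1`), `0 ≤ Λ + ζ`, and the MODELLING letter at threshold `x_K = b K + κ₁·log K` and over-age `m − b K`.
Then for `K ≥ 1`, `|t| ≤ l₀`: `wild K t ≤ C₀·(e^{Z₀}·e^{(Λ+ζ)b₀}∕(1 − e^{−(θ−Λ−ζ)}))·e^{−(κ₁(θ−Λ−ζ) − (Λ+ζ)δ)·log K}` — the exponent pays `(Λ+ζ)·δ`. -/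
theorem wildMass_rateAlongK_of_refreshProcess_growingBudget {l₀ : ℝ} (wild : ℕ → ℝ → ℝ)
    {θ Λ ζ κ₁ Z₀ C₀ b₀ δ : ℝ} (b : ℕ → ℝ) (hθ : 0 ≤ θ) (hΛθ : Λ + ζ < θ) (hΛζ : 0 ≤ Λ + ζ) (hC₀ : 0 ≤ C₀)
    (hb : ∀ K : ℕ, 1 ≤ K → b K ≤ b₀ + δ * Real.log (K : ℝ))
    (U : ℕ → ℝ → ℕ → Finset α) (w ℓ P : ℕ → ℝ → ℕ → α → ℝ)
    (hw0 : ∀ K t m, ∀ j ∈ U K t m, 0 ≤ w K t m j)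
    (hw : ∀ K t m, ∀ j ∈ U K t m, w K t m j ≤ Real.exp (-P K t m j))
    (hθP : ∀ K t m, ∀ j ∈ U K t m, θ * ℓ K t m j ≤ P K t m j / 2)
    (hZ : ∀ K t (m : ℕ), ∑ j ∈ U K t m, Real.exp (-(P K t m j / 2)) ≤ Z₀ + ζ * m)
    (hmodel : ∀ (K : ℕ) (t : ℝ), |t| ≤ l₀ → 1 ≤ K → ∀ s : ℝ,
      (∀ M : ℕ, ∑ m ∈ range M, (if b K + κ₁ * Real.log (K : ℝ) ≤ (m : ℝ) then
          Real.exp (Λ * m) * ∑ S ∈ (U K t m).powerset with ((m : ℝ) - b K ≤ ∑ j ∈ S, ℓ K t m j), ∏ j ∈ S, w K t m j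
        else 0) ≤ s) →
      wild K t ≤ C₀ * s) :
    ∀ (K : ℕ) (t : ℝ), |t| ≤ l₀ → 1 ≤ K →
      wild K t ≤ C₀ * (Real.exp Z₀ * Real.exp ((Λ + ζ) * b₀) / (1 - Real.exp (-(θ - Λ - ζ))))
        * Real.exp (-((κ₁ * (θ - Λ - ζ) - (Λ + ζ) * δ) * Real.log K)) := by
  intro K t ht hK
  have hrate := wildMass_rate_of_refreshProcess (U K t) (w K t) (ℓ K t) (P K t) (hw0 K t) (hw K t) hθ (hθP K t)
    (hZ K t) hΛθ (b K) (b K + κ₁ * Real.log (K : ℝ)) (hmodel K t ht hK)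
  have hD : 0 < 1 - Real.exp (-(θ - Λ - ζ)) := sub_pos.2 (Real.exp_lt_one_iff.2 (by linarith))
  have hC₀D : 0 ≤ C₀ / (1 - Real.exp (-(θ - Λ - ζ))) := div_nonneg hC₀ hD.le
  -- regroup the exponentials of the uniform-budget rate at budget `b K`
  have e : Real.exp (Z₀ + θ * b K) * Real.exp (-((θ - Λ - ζ) * (b K + κ₁ * Real.log (K : ℝ))))
      = Real.exp Z₀ * Real.exp ((Λ + ζ) * b K) * Real.exp (-(κ₁ * (θ - Λ - ζ) * Real.log (K : ℝ))) := by
    rw [← Real.exp_add, ← Real.exp_add, ← Real.exp_add]; congr 1; ring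
  have step1 : wild K t ≤ C₀ / (1 - Real.exp (-(θ - Λ - ζ)))
      * (Real.exp Z₀ * Real.exp ((Λ + ζ) * b K) * Real.exp (-(κ₁ * (θ - Λ - ζ) * Real.log (K : ℝ)))) := by
    rw [← e]
    calc wild K t ≤ _ := hrate
      _ = _ := by ring
  -- the growth letter: `e^{(Λ+ζ) b_K} ≤ e^{(Λ+ζ) b₀}·e^{(Λ+ζ) δ log K}`, then merge with the rate
  have hbud : Real.exp ((Λ + ζ) * b K) ≤ Real.exp ((Λ + ζ) * b₀) * Real.exp ((Λ + ζ) * δ * Real.log (K : ℝ)) := by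
    rw [← Real.exp_add]
    exact Real.exp_le_exp.2 (by nlinarith [mul_le_mul_of_nonneg_left (hb K hK) hΛζ])
  have step2 : Real.exp Z₀ * Real.exp ((Λ + ζ) * b K) * Real.exp (-(κ₁ * (θ - Λ - ζ) * Real.log (K : ℝ)))
      ≤ Real.exp Z₀ * Real.exp ((Λ + ζ) * b₀) * Real.exp (-((κ₁ * (θ - Λ - ζ) - (Λ + ζ) * δ) * Real.log (K : ℝ))) := by
    have e2 : Real.exp ((Λ + ζ) * δ * Real.log (K : ℝ)) * Real.exp (-(κ₁ * (θ - Λ - ζ) * Real.log (K : ℝ)))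
        = Real.exp (-((κ₁ * (θ - Λ - ζ) - (Λ + ζ) * δ) * Real.log (K : ℝ))) := by
      rw [← Real.exp_add]; congr 1; ring
    calc Real.exp Z₀ * Real.exp ((Λ + ζ) * b K) * Real.exp (-(κ₁ * (θ - Λ - ζ) * Real.log (K : ℝ)))
        ≤ Real.exp Z₀ * (Real.exp ((Λ + ζ) * b₀) * Real.exp ((Λ + ζ) * δ * Real.log (K : ℝ)))
            * Real.exp (-(κ₁ * (θ - Λ - ζ) * Real.log (K : ℝ))) :=
          mul_le_mul_of_nonneg_right (mul_le_mul_of_nonneg_left hbud (Real.exp_nonneg _)) (Real.exp_nonneg _)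
      _ = Real.exp Z₀ * Real.exp ((Λ + ζ) * b₀) * Real.exp (-((κ₁ * (θ - Λ - ζ) - (Λ + ζ) * δ) * Real.log (K : ℝ))) := by
          rw [← e2]; ring
  calc wild K t ≤ _ := step1
    _ ≤ C₀ / (1 - Real.exp (-(θ - Λ - ζ)))
        * (Real.exp Z₀ * Real.exp ((Λ + ζ) * b₀) * Real.exp (-((κ₁ * (θ - Λ - ζ) - (Λ + ζ) * δ) * Real.log (K : ℝ)))) :=
        mul_le_mul_of_nonneg_left step2 hC₀D
    _ = _ := by ring

end Rate

/-! ## §2 The (V‑a) block and the exponent-1 edition with a growing budget -/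

section Summable
variable {α : Type*}

/-- **★★★ THE (V‑a) BINDER BLOCK WITH A GROWING BUDGET.**  The letters of `wildMass_rateAlongK_of_refreshProcess_growingBudget`, the a-priori bound `wild K t ≤ 1`
on the window (serves `K = 0`), and the STRENGTHENED margin `2 < κ₁·(θ − Λ − ζ) − (Λ + ζ)·δ` ⇒ `∃ wm ≥ 0`, `Summable (√wm)`, `wild K t ≤ wm K` for all `K`,
`|t| ≤ l₀` — the `(wm, hwm, hwild, hws)` binders of p618979's `affinityDefectLetter_of_tameTilts` (`δ = 0` is p621610's `wildMass_summable_of_refreshProcess`). -/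
theorem wildMass_summable_of_refreshProcess_growingBudget {l₀ : ℝ} (wild : ℕ → ℝ → ℝ)
    (hwild1 : ∀ K t, |t| ≤ l₀ → wild K t ≤ 1)
    {θ Λ ζ κ₁ Z₀ C₀ b₀ δ : ℝ} (b : ℕ → ℝ) (hθ : 0 ≤ θ) (hΛθ : Λ + ζ < θ) (hΛζ : 0 ≤ Λ + ζ)
    (hκ : 2 < κ₁ * (θ - Λ - ζ) - (Λ + ζ) * δ) (hC₀ : 0 ≤ C₀)
    (hb : ∀ K : ℕ, 1 ≤ K → b K ≤ b₀ + δ * Real.log (K : ℝ))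
    (U : ℕ → ℝ → ℕ → Finset α) (w ℓ P : ℕ → ℝ → ℕ → α → ℝ)
    (hw0 : ∀ K t m, ∀ j ∈ U K t m, 0 ≤ w K t m j)
    (hw : ∀ K t m, ∀ j ∈ U K t m, w K t m j ≤ Real.exp (-P K t m j))
    (hθP : ∀ K t m, ∀ j ∈ U K t m, θ * ℓ K t m j ≤ P K t m j / 2)
    (hZ : ∀ K t (m : ℕ), ∑ j ∈ U K t m, Real.exp (-(P K t m j / 2)) ≤ Z₀ + ζ * m)
    (hmodel : ∀ (K : ℕ) (t : ℝ), |t| ≤ l₀ → 1 ≤ K → ∀ s : ℝ,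
      (∀ M : ℕ, ∑ m ∈ range M, (if b K + κ₁ * Real.log (K : ℝ) ≤ (m : ℝ) then
          Real.exp (Λ * m) * ∑ S ∈ (U K t m).powerset with ((m : ℝ) - b K ≤ ∑ j ∈ S, ℓ K t m j), ∏ j ∈ S, w K t m j
        else 0) ≤ s) →
      wild K t ≤ C₀ * s) :
    ∃ wm : ℕ → ℝ, (∀ K, 0 ≤ wm K) ∧ Summable (fun K => Real.sqrt (wm K)) ∧
      ∀ K t, |t| ≤ l₀ → wild K t ≤ wm K := by
  have hrate := wildMass_rateAlongK_of_refreshProcess_growingBudget wild b hθ hΛθ hΛζ hC₀ hb U w ℓ P hw0 hw hθP hZ hmodel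
  have hD : 0 < 1 - Real.exp (-(θ - Λ - ζ)) := sub_pos.2 (Real.exp_lt_one_iff.2 (by linarith))
  set C : ℝ := C₀ * (Real.exp Z₀ * Real.exp ((Λ + ζ) * b₀) / (1 - Real.exp (-(θ - Λ - ζ)))) with hC
  have hC0 : 0 ≤ C := mul_nonneg hC₀ (div_nonneg (mul_nonneg (Real.exp_nonneg _) (Real.exp_nonneg _)) hD.le)
  refine ⟨fun K => C * Real.exp (-((κ₁ * (θ - Λ - ζ) - (Λ + ζ) * δ) * Real.log K)) + (if K = 0 then 1 else 0),
    fun K => ?_, ?_, fun K t ht => ?_⟩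
  · have : 0 ≤ (if K = 0 then (1:ℝ) else 0) := by split_ifs <;> norm_num
    exact add_nonneg (mul_nonneg hC0 (Real.exp_nonneg _)) this
  · refine summable_sqrt_of_le_exp_log hC0 hκ _ (fun K hK => ?_)
    rw [if_neg (by omega), add_zero]
  · dsimp only
    by_cases hK : K = 0
    · subst hK
      rw [if_pos rfl]
      have := hwild1 0 t ht
      have : 0 ≤ C * Real.exp (-((κ₁ * (θ - Λ - ζ) - (Λ + ζ) * δ) * Real.log ((0:ℕ):ℝ))) :=
        mul_nonneg hC0 (Real.exp_nonneg _)
      linarith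
    · rw [if_neg hK, add_zero]
      exact hrate K t ht (Nat.one_le_iff_ne_zero.2 hK)

/-- [folklore] **THE EXPONENT-1 EDITION WITH A GROWING BUDGET** (`window-key-core`'s booked-mass letter (AC)): the same letters with `1 < κ₁·(θ − Λ − ζ) − (Λ + ζ)·δ`
give `∃ wm ≥ 0` with `Summable wm` and `wild K t ≤ wm K` for all `K`, `|t| ≤ l₀`. -/
theorem wildMass_summableOne_of_refreshProcess_growingBudget {l₀ : ℝ} (wild : ℕ → ℝ → ℝ)
    (hwild1 : ∀ K t, |t| ≤ l₀ → wild K t ≤ 1)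
    {θ Λ ζ κ₁ Z₀ C₀ b₀ δ : ℝ} (b : ℕ → ℝ) (hθ : 0 ≤ θ) (hΛθ : Λ + ζ < θ) (hΛζ : 0 ≤ Λ + ζ)
    (hκ : 1 < κ₁ * (θ - Λ - ζ) - (Λ + ζ) * δ) (hC₀ : 0 ≤ C₀)
    (hb : ∀ K : ℕ, 1 ≤ K → b K ≤ b₀ + δ * Real.log (K : ℝ))
    (U : ℕ → ℝ → ℕ → Finset α) (w ℓ P : ℕ → ℝ → ℕ → α → ℝ)
    (hw0 : ∀ K t m, ∀ j ∈ U K t m, 0 ≤ w K t m j)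
    (hw : ∀ K t m, ∀ j ∈ U K t m, w K t m j ≤ Real.exp (-P K t m j))
    (hθP : ∀ K t m, ∀ j ∈ U K t m, θ * ℓ K t m j ≤ P K t m j / 2)
    (hZ : ∀ K t (m : ℕ), ∑ j ∈ U K t m, Real.exp (-(P K t m j / 2)) ≤ Z₀ + ζ * m)
    (hmodel : ∀ (K : ℕ) (t : ℝ), |t| ≤ l₀ → 1 ≤ K → ∀ s : ℝ,
      (∀ M : ℕ, ∑ m ∈ range M, (if b K + κ₁ * Real.log (K : ℝ) ≤ (m : ℝ) then
          Real.exp (Λ * m) * ∑ S ∈ (U K t m).powerset with ((m : ℝ) - b K ≤ ∑ j ∈ S, ℓ K t m j), ∏ j ∈ S, w K t m j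
        else 0) ≤ s) →
      wild K t ≤ C₀ * s) :
    ∃ wm : ℕ → ℝ, (∀ K, 0 ≤ wm K) ∧ Summable wm ∧ ∀ K t, |t| ≤ l₀ → wild K t ≤ wm K := by
  have hrate := wildMass_rateAlongK_of_refreshProcess_growingBudget wild b hθ hΛθ hΛζ hC₀ hb U w ℓ P hw0 hw hθP hZ hmodel
  have hD : 0 < 1 - Real.exp (-(θ - Λ - ζ)) := sub_pos.2 (Real.exp_lt_one_iff.2 (by linarith))
  set C : ℝ := C₀ * (Real.exp Z₀ * Real.exp ((Λ + ζ) * b₀) / (1 - Real.exp (-(θ - Λ - ζ)))) with hC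
  have hC0 : 0 ≤ C := mul_nonneg hC₀ (div_nonneg (mul_nonneg (Real.exp_nonneg _) (Real.exp_nonneg _)) hD.le)
  have hhead : Summable fun K : ℕ => (if K = 0 then (1:ℝ) else 0) := by
    refine summable_of_ne_finset_zero (s := {0}) fun K hK => ?_
    rw [mem_singleton] at hK
    simp [hK]
  refine ⟨fun K => C * Real.exp (-((κ₁ * (θ - Λ - ζ) - (Λ + ζ) * δ) * Real.log K)) + (if K = 0 then 1 else 0),
    fun K => ?_, ?_, fun K t ht => ?_⟩
  · have : 0 ≤ (if K = 0 then (1:ℝ) else 0) := by split_ifs <;> norm_num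
    exact add_nonneg (mul_nonneg hC0 (Real.exp_nonneg _)) this
  · refine Summable.add ?_ hhead
    exact summable_of_le_exp_log (C := C) hκ _ (fun K => mul_nonneg hC0 (Real.exp_nonneg _)) fun K _ => le_rfl
  · dsimp only
    by_cases hK : K = 0
    · subst hK
      rw [if_pos rfl]
      have := hwild1 0 t ht
      have : 0 ≤ C * Real.exp (-((κ₁ * (θ - Λ - ζ) - (Λ + ζ) * δ) * Real.log ((0:ℕ):ℝ))) :=
        mul_nonneg hC0 (Real.exp_nonneg _)
      linarith
    · rw [if_neg hK, add_zero]
      exact hrate K t ht (Nat.one_le_iff_ne_zero.2 hK)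

end Summable

/-! ## §3 With the Peierls letters: the K-dependent `hmodel` supplied by p623281's one-`(K,t)` composition -/

section Peierls
variable {α : Type*} [DecidableEq α] {π : Type*}

/-- **★★ THE (V‑a) BLOCK WITH A GROWING BUDGET FROM THE PEIERLS LETTERS.**  As `wildMass_summable_of_refreshProcess_growingBudget`, with its modelling hypothesis
replaced by p623281's letters at the budget `b K`: (POS) `#(Pos K m) ≤ e^{Λm}`; per `(K,t,m,p)` a down-closed weight system `𝒜 ∕ A ≥ 0` with deficit factorisation
over `w K t m ≥ 0` (KR-dc) and over-aged predicates `Over` with the pendency containment at over-age `m − b K` (PEND); (BIRTH) with horizon `M K` at the threshold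
`b K + κ₁·log K`.  Conclusion: the (V‑a) block. -/
theorem wildMass_summable_of_peierlsLetters_growingBudget {l₀ : ℝ} (wild : ℕ → ℝ → ℝ)
    (hwild1 : ∀ K t, |t| ≤ l₀ → wild K t ≤ 1)
    {θ Λ ζ κ₁ Z₀ C₀ b₀ δ : ℝ} (b : ℕ → ℝ) (hθ : 0 ≤ θ) (hΛθ : Λ + ζ < θ) (hΛζ : 0 ≤ Λ + ζ)
    (hκ : 2 < κ₁ * (θ - Λ - ζ) - (Λ + ζ) * δ) (hC₀ : 0 ≤ C₀)
    (hb : ∀ K : ℕ, 1 ≤ K → b K ≤ b₀ + δ * Real.log (K : ℝ))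
    (U : ℕ → ℝ → ℕ → Finset α) (w ℓ P : ℕ → ℝ → ℕ → α → ℝ)
    (hw0 : ∀ K t m j, 0 ≤ w K t m j)
    (hw : ∀ K t m, ∀ j ∈ U K t m, w K t m j ≤ Real.exp (-P K t m j))
    (hθP : ∀ K t m, ∀ j ∈ U K t m, θ * ℓ K t m j ≤ P K t m j / 2)
    (hZ : ∀ K t (m : ℕ), ∑ j ∈ U K t m, Real.exp (-(P K t m j / 2)) ≤ Z₀ + ζ * m)
    (Pos : ℕ → ℕ → Finset π) (hpos : ∀ K m, ((Pos K m).card : ℝ) ≤ Real.exp (Λ * m))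
    (𝒜 : ℕ → ℝ → ℕ → π → Finset (Finset α)) (A : ℕ → ℝ → ℕ → π → Finset α → ℝ)
    (hA : ∀ K t m p, ∀ X ∈ 𝒜 K t m p, 0 ≤ A K t m p X)
    (hdown : ∀ K t m p, ∀ X ∈ 𝒜 K t m p, ∀ Y, Y ⊆ X → Y ∈ 𝒜 K t m p)
    (hfac : ∀ K t m p, ∀ X ∈ 𝒜 K t m p, ∀ S, S ⊆ X → A K t m p X ≤ (∏ j ∈ S, w K t m j) * A K t m p (X \ S))
    (Over : ℕ → ℝ → ℕ → π → Finset α → Prop) [∀ K t m p, DecidablePred (Over K t m p)]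
    (hpend : ∀ K t m p, ∀ X ∈ 𝒜 K t m p, Over K t m p X → ∃ S, S ⊆ U K t m ∧ ((m : ℝ) - b K ≤ ∑ j ∈ S, ℓ K t m j) ∧ S ⊆ X)
    (M : ℕ → ℕ)
    (hbirth : ∀ (K : ℕ) (t : ℝ), |t| ≤ l₀ → 1 ≤ K → wild K t ≤ C₀ * ∑ m ∈ range (M K),
      (if b K + κ₁ * Real.log (K : ℝ) ≤ (m : ℝ) then
        ∑ p ∈ Pos K m, (∑ X ∈ 𝒜 K t m p with Over K t m p X, A K t m p X) / (∑ Y ∈ 𝒜 K t m p, A K t m p Y) else 0)) :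
    ∃ wm : ℕ → ℝ, (∀ K, 0 ≤ wm K) ∧ Summable (fun K => Real.sqrt (wm K)) ∧
      ∀ K t, |t| ≤ l₀ → wild K t ≤ wm K :=
  wildMass_summable_of_refreshProcess_growingBudget wild hwild1 b hθ hΛθ hΛζ hκ hC₀ hb U w ℓ P
    (fun K t m j _ => hw0 K t m j) hw hθP hZ
    (fun K t ht hK => modellingLetter_of_peierlsLetters (U K t) (w K t) (ℓ K t) (hw0 K t) (b K)
      (b K + κ₁ * Real.log (K : ℝ)) (Pos K) (hpos K) (𝒜 K t) (A K t) (hA K t) (hdown K t) (hfac K t) (Over K t)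
      (hpend K t) hC₀ (M K) (hbirth K t ht hK))

end Peierls

/-! ## §4 Toys (A6) -/

/-- Toy (A6): with `δ = 0` the strengthened exponent is p621610's `κ₁(θ − Λ − ζ)` verbatim (no growth, no cost). -/
theorem toy_exponent_noGrowth (θ Λ ζ κ₁ : ℝ) : κ₁ * (θ - Λ - ζ) - (Λ + ζ) * 0 = κ₁ * (θ - Λ - ζ) := by ring

/-- Toy (A6): the strengthened margin is inhabited WITH growth in a caricature of print's regime — `L = 2` (`Λ = 4 log 2`), `ζ = e^{−10}`, `θ = 10`, `κ₁ = 1`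
and budget growth `δ = 1`: `2 < κ₁(θ − Λ − ζ) − (Λ + ζ)·δ` (indeed `≈ 4.45`), together with `0 ≤ Λ + ζ` and `Λ + ζ < θ`. -/
theorem toy_growingBudget_margin :
    (0 ≤ 4 * Real.log 2 + Real.exp (-10)) ∧ (4 * Real.log 2 + Real.exp (-10) < 10) ∧
      (2 < 1 * (10 - 4 * Real.log 2 - Real.exp (-10)) - (4 * Real.log 2 + Real.exp (-10)) * 1) := by
  have h2 : Real.log 2 < 0.6931471808 := Real.log_two_lt_d9
  have h2' : 0 < Real.log 2 := Real.log_pos (by norm_num)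
  have he : Real.exp (-10) ≤ 1 := Real.exp_le_one_iff.2 (by norm_num)
  have he0 : 0 < Real.exp (-10) := Real.exp_pos _
  refine ⟨by linarith, by linarith, by linarith⟩

end Summit.QuantumFields.YangMills.BalabanUVNodes.N19OverAgeRateGrowingBudget
end
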